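import Literature.NumberTheory.EllipticCurves.QuadraticTwistLocalPolynomialTwoProofs
import Literature.NumberTheory.EllipticCurves.QuadraticTwistKroneckerLFunctionProofs
import Literature.NumberTheory.EllipticCurves.QuadraticTwistProofs
import Literature.NumberTheory.EllipticCurves.LFunctionPrimeCoeff
import Literature.NumberTheory.DiophantineGeometry.LocalReductionProofs
import HarnessLib

/-!
# Good quadratic twists at the prime `2`: `d ≡ 1 (mod 4)` preserves good reduction and twists `a_2`

Cell `bsd-goldfeld` (planner seat), file 1 of 3 (local analysis; the density bookkeeping is
`GoldfeldGoodTwistsDensity`, the assembly for `X₀(49)` is `GoldfeldGoodTwistsX049`). Theorems only —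
no named fact, no axiom, no definition. HONEST FRAMING: elementary local analysis, proved outright
from the tree's explicit `2`-integral twist model; nothing deep is claimed here.

**Main statement.** `hasGoodReductionAtPrime_and_frobeniusTrace_of_smul_eq_quadraticTwist_two`:
for `W / ℚ` globally minimal with good reduction at `2`, `d ≡ 1 (mod 4)`, and `C • W' = W^{(d)}` with
`W'` globally minimal, `W'` has good reduction at `2` and `a_2(W') = (d | 2) · a_2(W)` — `+ a_2(W)` if
`d ≡ 1 (mod 8)`, `− a_2(W)` if `d ≡ 5 (mod 8)`. In particular a twist by `d ≡ 1 (mod 4)` of a curve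
good ORDINARY at `2` is again good ordinary at `2` (the input the CM `2`-converse theorems need).
Proof: over `ℚ_2` the twist is, up to a change of variables, the explicit integral model `X'_c`
(`d = 1 + 4c`) of `QuadraticTwistLocalPolynomialTwoProofs` (`exists_baseChange_twistLiftTwo_eq_smul`),
which is minimal with good reduction (`isMinimal_baseChange_twistLiftTwo`,
`hasGoodReduction_twistLiftTwo_iff`) and whose reduction is the Artin–Schreier twist of `W̃` by `c̄`:
`#X̃'_c(𝔽_2) − 3 = ± (#W̃(𝔽_2) − 3)` with `+` iff `c̄ = 0`
(`card_sub_natCard_point_reduction_twistLiftTwo`); two minimal models of the same curve have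
`𝔽_2`-isomorphic reductions (Silverman VII.1.3(b): `exists_variableChange_baseChange_eq_of_isMinimal`,
`reduction_smul_eq_of_baseChange_eq`), and the point count of the reduction of a globally minimal
`W` at `v` is the tree's `reductionPointCount W p`
(`natCard_point_reduction_baseChange_eq_reductionPointCount`).

References: J. H. Silverman, *AEC* (2009), VII.1.3, App. A Prop. 1.1(b), Ex. A.2 [SilvermanAEC2009].
-/

set_option linter.dupNamespace false
set_option autoImplicit false

noncomputable section

open scoped Classical

open IsLocalRing IsDiscreteValuationRing IsDedekindDomain IsDedekindDomain.HeightOneSpectrum NumberField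
  Rat.HeightOneSpectrum WeierstrassCurve Literature.NumberTheory.EllipticCurves

namespace Summit.BirchSwinnertonDyer.BirchSwinnertonDyer.Theorems.GoldfeldGoodTwists

/-- Notation (local to this file, copied from `QuadraticTwistLocalPolynomialTwoProofs`) for the
explicit `R`-model `X'_c` of the twist of `X` by `1 + 4c`. -/
local notation3 "𝕋[" R ", " X ", " c "]" =>
  (⟨(WeierstrassCurve.integralModel R X).a₁,
    c * (WeierstrassCurve.integralModel R X).a₁ ^ 2 + (1 + 4 * c) * (WeierstrassCurve.integralModel R X).a₂,
    (1 + 4 * c) * (WeierstrassCurve.integralModel R X).a₃,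
    2 * (1 + 4 * c) * c * (WeierstrassCurve.integralModel R X).a₁ * (WeierstrassCurve.integralModel R X).a₃ +
      (1 + 4 * c) ^ 2 * (WeierstrassCurve.integralModel R X).a₄,
    (1 + 4 * c) ^ 2 * c * (WeierstrassCurve.integralModel R X).a₃ ^ 2 +
      (1 + 4 * c) ^ 3 * (WeierstrassCurve.integralModel R X).a₆⟩ : WeierstrassCurve R)

/-- Equal minimal equations have reductions with equally many points (a `subst` helper: the
reduction carries its minimality instance). [folklore] -/
theorem natCard_point_reduction_congr (R : Type*) [CommRing R] [IsDomain R]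
    [IsDiscreteValuationRing R] {K : Type*} [Field K] [Algebra R K] [IsFractionRing R K]
    {X Y : WeierstrassCurve K} [IsMinimal R X] [IsMinimal R Y] (h : X = Y) :
    Nat.card (X.reduction R).toAffine.Point = Nat.card (Y.reduction R).toAffine.Point := by
  subst h; rfl

/-- For a globally minimal `W / ℚ` and the place `v` of `ℚ` over `p`, the reduction of `W ⊗ ℚ_v`
over `κ(v)` has `reductionPointCount W p` points. [folklore] -/
theorem natCard_point_reduction_baseChange_eq_reductionPointCount (W : WeierstrassCurve ℚ)
    [W.IsGloballyMinimal] (v : HeightOneSpectrum (𝓞 ℚ)) :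
    haveI : (W.baseChange (v.adicCompletion ℚ)).IsMinimal (v.adicCompletionIntegers ℚ) :=
      IsGloballyMinimal.isMinimal v
    Nat.card ((W.baseChange (v.adicCompletion ℚ)).reduction
        (v.adicCompletionIntegers ℚ)).toAffine.Point = reductionPointCount W (primesEquiv v : ℕ) := by
  haveI := Fact.mk (primesEquiv v).2
  haveI : (W.baseChange (v.adicCompletion ℚ)).IsMinimal (v.adicCompletionIntegers ℚ) :=
    IsGloballyMinimal.isMinimal v
  let e : IsLocalRing.ResidueField (v.adicCompletionIntegers ℚ) ≃+* ZMod (primesEquiv v : ℕ) :=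
    (IsLocalRing.ResidueField.mapEquiv
      (adicCompletionIntegers.padicIntEquiv v).toAlgEquiv.toRingEquiv).trans PadicInt.residueField
  rw [reduction, integralModel_eq_of_baseChange_eq (W.baseChange (v.adicCompletion ℚ))
    ((integralModelInt W).map (Int.castRingHom (v.adicCompletionIntegers ℚ))) ?_,
    WeierstrassCurve.map_map, ← natCard_point_map_ringEquiv e, WeierstrassCurve.map_map,
    reductionPointCount]
  · exact congrArg (fun f : ℤ →+* ZMod (primesEquiv v : ℕ) ↦
      Nat.card ((integralModelInt W).map f).toAffine.Point) (RingHom.ext_int _ _)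
  · conv_rhs => rw [← map_integralModelInt W]
    rw [baseChange, baseChange, WeierstrassCurve.map_map, WeierstrassCurve.map_map]
    exact congrArg (integralModelInt W).map (RingHom.ext_int _ _)

/-- **Good ordinary reduction at `2` is stable under quadratic twists by `d ≡ 1 (mod 4)`** (the
twisting character is unramified at `2`). Let `W, W' / ℚ` be globally minimal, `W` elliptic with
good reduction at `p = 2`, and `C • W' = W^{(d)}` with `d ≡ 1 (mod 4)`. Then `W'` has good
reduction at `2` and `a_2(W') = χ(d) a_2(W)` with `χ(d) = 1` if `d ≡ 1 (mod 8)` and `−1` if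
`d ≡ 5 (mod 8)` (the Kronecker symbol `(d/2)`): at the place `v` over `2`, `W^{(d)} ⊗ ℚ_v` is
`ℚ_v`-isomorphic to the integral twist model `X'_c` (`d = 1 + 4c`) of `X = W ⊗ ℚ_v`, which is
minimal with good reduction and whose reduction is the Artin–Schreier twist of `X̃` by `c̄`
(`QuadraticTwistLocalPolynomialTwoProofs`); two minimal models have `𝔽_2`-isomorphic reductions
(Silverman VII.1.3(b)). Stated for a prime `p` with `p = 2` so that the place over `p` can be
substituted. [cite: SilvermanAEC2009, VII.1 Prop. 1.3(b), VII.5 Prop. 5.1(a), App. A Prop. A.1.1] -/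
theorem hasGoodReductionAtPrime_and_frobeniusTrace_of_smul_eq_quadraticTwist_two
    (W W' : WeierstrassCurve ℚ) [W.IsElliptic] [W.IsGloballyMinimal] [W'.IsGloballyMinimal]
    {d : ℤ} (hd4 : d % 4 = 1) {C : VariableChange ℚ} (hC : C • W' = W.quadraticTwist (d : ℚ))
    (p : ℕ) [Fact p.Prime] (hp : p = 2) (hgood : W.HasGoodReductionAtPrime p) :
    W'.HasGoodReductionAtPrime p ∧
      W'.frobeniusTrace p = (if d % 8 = 1 then 1 else -1) * W.frobeniusTrace p := by
  obtain ⟨v, rfl⟩ : ∃ v : HeightOneSpectrum (𝓞 ℚ), ((primesEquiv v : ℕ)) = p :=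
    ⟨primesEquiv.symm ⟨p, Fact.out⟩, by rw [Equiv.apply_symm_apply]⟩
  -- `d = 1 + 4c`
  set c : ℤ := (d - 1) / 4 with hcdef
  have hdc : d = 1 + 4 * c := by omega
  have hd0 : (d : ℚ) ≠ 0 := by exact_mod_cast (show d ≠ 0 by omega)
  -- the place `v` over `2`: `2 ∈ 𝔪_v`, `2 ≠ 0` in `ℚ_v`
  haveI : NeZero (2 : v.adicCompletion ℚ) := ⟨by
    rw [← map_ofNat (algebraMap ℚ (v.adicCompletion ℚ)) 2]; exact (map_ne_zero _).mpr two_ne_zero⟩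
  have hk : residue _ (2 : v.adicCompletionIntegers ℚ) = 0 := by
    have := residue_adicCompletionIntegers_intCast_eq_zero v (n := 2) (by rw [hp]; norm_num)
    simpa using this
  -- `X = W ⊗ ℚ_v` is minimal with good reduction
  haveI hXmin : (W.baseChange (v.adicCompletion ℚ)).IsMinimal (v.adicCompletionIntegers ℚ) :=
    IsGloballyMinimal.isMinimal v
  haveI hW'min : (W'.baseChange (v.adicCompletion ℚ)).IsMinimal (v.adicCompletionIntegers ℚ) :=
    IsGloballyMinimal.isMinimal v
  have hWv : W.HasGoodReductionAt v :=
    (hasGoodReductionAtPrime_iff_hasGoodReductionAt_ringOfIntegers v W).mp hgood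
  have hDW : W.localMinimalModel v =
      ((W.baseChange (v.adicCompletion ℚ)).exists_isMinimal (v.adicCompletionIntegers ℚ)).choose •
        W.baseChange (v.adicCompletion ℚ) := rfl
  have hXgood : (W.baseChange (v.adicCompletion ℚ)).HasGoodReduction (v.adicCompletionIntegers ℚ) :=
    (hasGoodReduction_iff_of_isMinimal_of_eq_smul (v.adicCompletionIntegers ℚ) hDW).mp hWv
  -- the twist model `T = X'_c ⊗ ℚ_v` is minimal with good reduction
  haveI hTmin : ((𝕋[v.adicCompletionIntegers ℚ, W.baseChange (v.adicCompletion ℚ),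
      (c : v.adicCompletionIntegers ℚ)]).baseChange (v.adicCompletion ℚ)).IsMinimal
        (v.adicCompletionIntegers ℚ) :=
    isMinimal_baseChange_twistLiftTwo _ hk _ _
  have hTgood : ((𝕋[v.adicCompletionIntegers ℚ, W.baseChange (v.adicCompletion ℚ),
      (c : v.adicCompletionIntegers ℚ)]).baseChange (v.adicCompletion ℚ)).HasGoodReduction
        (v.adicCompletionIntegers ℚ) :=
    (hasGoodReduction_twistLiftTwo_iff (v.adicCompletionIntegers ℚ) hk).mpr hXgood
  -- `T = E • (W' ⊗ ℚ_v)` for a change of variables `E` over `ℚ_v`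
  have htw : (W.quadraticTwist (d : ℚ)).baseChange (v.adicCompletion ℚ) =
      (W.baseChange (v.adicCompletion ℚ)).quadraticTwist
        (algebraMap (v.adicCompletionIntegers ℚ) (v.adicCompletion ℚ)
          (1 + 4 * (c : v.adicCompletionIntegers ℚ))) := by
    rw [baseChange, map_quadraticTwist, show (1 + 4 * (c : v.adicCompletionIntegers ℚ)) =
      ((1 + 4 * c : ℤ) : v.adicCompletionIntegers ℚ) by push_cast; ring, ← hdc,
      algebraMap_adicCompletionIntegers_intCast]
    rfl
  have hCX : C.baseChange (v.adicCompletion ℚ) • W'.baseChange (v.adicCompletion ℚ) =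
      (W.quadraticTwist (d : ℚ)).baseChange (v.adicCompletion ℚ) := by
    rw [← baseChange_smul_eq, hC]
  obtain ⟨D, hD⟩ := exists_baseChange_twistLiftTwo_eq_smul (v.adicCompletionIntegers ℚ)
    (W.baseChange (v.adicCompletion ℚ)) (c : v.adicCompletionIntegers ℚ)
  have hT : (𝕋[v.adicCompletionIntegers ℚ, W.baseChange (v.adicCompletion ℚ),
      (c : v.adicCompletionIntegers ℚ)]).baseChange (v.adicCompletion ℚ) =
      (D * C.baseChange (v.adicCompletion ℚ)) • W'.baseChange (v.adicCompletion ℚ) := by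
    rw [hD, ← htw, ← hCX, smul_smul]
  haveI : ((D * C.baseChange (v.adicCompletion ℚ)) • W'.baseChange (v.adicCompletion ℚ)).IsMinimal
      (v.adicCompletionIntegers ℚ) := by rw [← hT]; exact hTmin
  -- good reduction of `W'` at `v`
  have hW'bc : (W'.baseChange (v.adicCompletion ℚ)).HasGoodReduction (v.adicCompletionIntegers ℚ) :=
    (hasGoodReduction_iff_of_isMinimal_of_eq_smul (v.adicCompletionIntegers ℚ) hT).mp hTgood
  have hDW' : W'.localMinimalModel v =
      ((W'.baseChange (v.adicCompletion ℚ)).exists_isMinimal (v.adicCompletionIntegers ℚ)).choose •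
        W'.baseChange (v.adicCompletion ℚ) := rfl
  have hW'v : W'.HasGoodReductionAt v :=
    (hasGoodReduction_iff_of_isMinimal_of_eq_smul (v.adicCompletionIntegers ℚ) hDW').mpr hW'bc
  refine ⟨(hasGoodReductionAtPrime_iff_hasGoodReductionAt_ringOfIntegers v W').mpr hW'v, ?_⟩
  -- point counts: the reductions of `T` and `W' ⊗ ℚ_v` are `κ(v)`-isomorphic
  have hΔW' : (W'.baseChange (v.adicCompletion ℚ)).Δ ≠ 0 := by
    haveI : (W.quadraticTwist (d : ℚ)).IsElliptic := W.isElliptic_quadraticTwist hd0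
    have hW'ell : W'.Δ ≠ 0 := by
      intro h
      have h' := congrArg WeierstrassCurve.Δ hC
      rw [variableChange_Δ, h, mul_zero] at h'
      exact (W.quadraticTwist (d : ℚ)).isUnit_Δ.ne_zero h'.symm
    rw [baseChange, map_Δ]
    exact (map_ne_zero _).mpr hW'ell
  obtain ⟨E, hE⟩ := exists_variableChange_baseChange_eq_of_isMinimal
    (R := v.adicCompletionIntegers ℚ) (W'.baseChange (v.adicCompletion ℚ))
    (D * C.baseChange (v.adicCompletion ℚ)) hΔW'
  have h1 : Nat.card (((𝕋[v.adicCompletionIntegers ℚ, W.baseChange (v.adicCompletion ℚ),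
      (c : v.adicCompletionIntegers ℚ)]).baseChange (v.adicCompletion ℚ)).reduction
        (v.adicCompletionIntegers ℚ)).toAffine.Point =
      Nat.card ((W'.baseChange (v.adicCompletion ℚ)).reduction
        (v.adicCompletionIntegers ℚ)).toAffine.Point := by
    rw [natCard_point_reduction_congr (v.adicCompletionIntegers ℚ) hT,
      reduction_smul_eq_of_baseChange_eq _ _ E hE, natCard_point_smul]
  -- the two reductions count `reductionPointCount`
  have h2 := natCard_point_reduction_baseChange_eq_reductionPointCount W' v
  have h3 := natCard_point_reduction_baseChange_eq_reductionPointCount W v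
  -- the twisting formula over `κ(v)`
  have key := card_sub_natCard_point_reduction_twistLiftTwo (v.adicCompletionIntegers ℚ)
    (X := W.baseChange (v.adicCompletion ℚ)) (c := (c : v.adicCompletionIntegers ℚ)) hk hXgood
  rw [natCard_residueField_adicCompletionIntegers v, h1, h2, h3] at key
  -- the sign
  obtain ⟨e, he⟩ := exists_residueField_ringEquiv_zmod v
  have hiff : (∃ z : ResidueField (v.adicCompletionIntegers ℚ),
      z ^ 2 + z = residue _ (c : v.adicCompletionIntegers ℚ)) ↔ d % 8 = 1 := by
    have h8 : (2 : ℤ) ∣ c ↔ d % 8 = 1 := by omega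
    rw [← h8]
    constructor
    · rintro ⟨z, hz⟩
      have h1 : e (residue _ (c : v.adicCompletionIntegers ℚ)) = 0 := by
        rw [← hz, map_add, map_pow]
        exact sq_add_self_eq_zero_of_eq_two hp (e z)
      rw [he] at h1
      have h3 : ((primesEquiv v : ℕ) : ℤ) ∣ c := (ZMod.intCast_zmod_eq_zero_iff_dvd c _).mp h1
      rwa [hp] at h3
    · intro h2c
      refine ⟨0, ?_⟩
      rw [residue_adicCompletionIntegers_intCast_eq_zero v (by rw [hp]; exact_mod_cast h2c)]
      ring
  unfold frobeniusTrace
  simp only [hiff] at key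
  exact key


end Summit.BirchSwinnertonDyer.BirchSwinnertonDyer.Theorems.GoldfeldGoodTwists

end
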